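import Summits.Ventures.Crystal3D.Theses.StickyWulffConstant
import Summits.Ventures.Crystal3D.Theorems.StickyWulffConstantNoReconstructionGainOfCertificate
import Summits.Ventures.Crystal3D.Theorems.StickyWulffConstantNoReconstructionGainCore
import Summits.Ventures.Crystal3D.Theorems.StickyWulffConstantNoReconstructionGainExactDefs
import Summits.Ventures.Crystal3D.Theorems.StickyWulffConstantNoReconstructionGainExactPeel
import Summits.Ventures.Crystal3D.Theorems.StickyWulffConstantNoReconstructionGainExactCompatible
import Summits.Ventures.Crystal3D.Theorems.StickyWulffConstantNoReconstructionGainExactCertificate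
import Summits.Ventures.Crystal3D.Theorems.StickyWulffConstantNoReconstructionGainExactReplication
import Summits.Ventures.Crystal3D.Theorems.StickyWulffConstantNoReconstructionGainExactLevelDeep
import Summits.Ventures.Crystal3D.Theorems.StickyWulffConstantNoReconstructionGainExactConfinementDefs
import Summits.Ventures.Crystal3D.Theorems.StickyWulffConstantNoReconstructionGainExactResidualDefs
import Summits.Ventures.Crystal3D.Theorems.StickyWulffConstantNoReconstructionGainExactFilmAboveCutAll
import HarnessLib

/-!
# Line `replication-exactness` — crux `NoReconstructionGain` (stmt-Ventures-19144, route StickyWulffConstant)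

v6 (lead g18, 2026-08-29): stubs UNCHANGED (`stub_noCriminal` = EXACT₀ = the crux proper;
`stub_manyWrappedCoreAdhesion` = crux-implied residual).  What changed is the landed ANATOMY of a criminal,
now imported (`…ExactFilmAboveCutAll` and its cone): any prover/refuter of `stub_noCriminal` may use, for a
criminal `Q` on `H(ν,s)` —
* every ball lies strictly above the cut (`IsFilmOn.lt_inner`, p700253) and every plug is ν-below its
  ball (`plug_below`); every ball has `plug + deg ≤ 12` (`plug_add_deg_le_twelve`, p697069) and
  `plug + deg ≥ 7` (`seven_le_plug_add_deg_of_criminal`);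
* the top ball has `7..9` partners, all ν-below (`exists_top_window_of_criminal`); some ball is CUPPED for
  EVERY orientation of the contact graph (`exists_seven_le_plug_add_indeg_of_criminal`, p698072), the
  ν-height cup has `7..9` members with `≥ 2` shallow (`exists_cup_window_of_criminal'`);
* `#Q_off ≥ 9` (`nine_le_card_offLattice_of_criminal`), `D(Q_off) < 3·#Q_off`, every off-lattice ball
  has `≤ 3` lattice contacts and `≥ 4` off-lattice partners, and some off-lattice ball is HEAVY:
  `deg_off + 2·latt ≥ 13`, hence `≥ 10` contacts, `≥ 7` off-lattice, `≥ 1` lattice, surrounded on every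
  side with a film partner strictly above (`exists_buried_offLattice_of_criminal'`, p698559/p700253).
Dead ends recorded in the lead's memo ANATOMY-g18 (evidence #44): cylinder re-cut of the residual,
pointwise force balance, cupped-twin mound (third-lattice theorem; cf-p2 R14d β/sin ≥ √6).

v5 (lead g17, 2026-08-29T03:0xZ): the registered residual is made CRUX-IMPLIED again:
`stub_manyWrappedCoreAdhesion : ManyWrappedCoreAdhesion` (…ExactResidualDefs) = the adhesion atom for
P-cores with MORE than `L·⌊(R−6)/2⌋·ρ` off-lattice balls in the deep band (a subclass of the old UNWRAP
class, so strictly smaller and licensed by the crux); the structural `CoreWrappedConfinement` of v4 implies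
it vacuously (`manyWrappedCoreAdhesion_of_confinement`, proved below) and stays the recommended attack, but
is NOT registered (it is not implied by the crux: a core with a wide off-lattice collar bound to a tall film
would violate confinement without violating the crux).  Composition v5: `NoCriminal ⟹ EXACT₀`; for a
core, if `#S ≤ L·K·ρ` the deep-band level bound gives the atom with `C₁ + C₂(1+R) + 12(L⁺+1)`, else the
residual stub gives it with its `C`; `adhesion_of_core`, `noReconstructionGain_of_adhesion`.  OPEN STUBS:
`stub_noCriminal` (XL = EXACT₀, the crux proper), `stub_manyWrappedCoreAdhesion` (L).

v4 (lead g17, 2026-08-29T02:5xZ): THE RESIDUAL IS RESHAPED.  New tree theorems of this seat — the LEVEL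
SANDWICH `contactDeficiency_ge_latticeCross_of_exactZeroGain` (…ExactLevel, p688544: under EXACT₀ the
deficiency of ANY packing is at least its lattice bonds across any off-lattice-free level), the interior
crossing count `sample_latticeCross_ge` (…ExactLevelSample, p688927) and
`deficit_ge_of_exactZeroGain_sub_offLattice[_deep]` (…ExactLevelBound p689714 / …ExactLevelDeep) — give,
from EXACT₀ ALONE, the crux's inequality `D(X) ≥ 2φ(ν)πρ² − Cρ − 12(⌊#S/K⌋+1)` for EVERY packing
`X ⊇ P_ρ(ν,R)`, where `S` = off-lattice balls in the deep height band `(−2R+2, −R−2)` (necessarily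
outside the disc: WRAPPED) and `K = ⌊(R−6)/2⌋`.  Hence the compatible/wrapped split of v1–v3 is
SUPERSEDED: the composition below is `NoCriminal ⟹ EXACT₀` (peel, landed) `⟹` [deep-band bound, landed]
`+ stub_coreWrappedConfinement` (NEW RESIDUAL: a P-core has `≤ L·K·ρ` off-lattice wrapped balls in the
deep band — a CONFINEMENT statement, strictly weaker than the old UNWRAP `stub_wrappedCoreAdhesion`,
which asked for the whole adhesion inequality on wrapped cores) `⟹` adhesion on cores `⟹`
(`adhesion_of_core`, `noReconstructionGain_of_adhesion`) the crux BY NAME.  OPEN: `stub_noCriminal` (XL,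
the crux proper = EXACT₀) and `stub_coreWrappedConfinement` (M/L).  `stub_wrappedCoreAdhesion` is RETIRED
(not refuted; no longer needed).

v3 (lead g17, 2026-08-29T02:0xZ): FOUR of the six stubs are LANDED BY NAME and closed below by the tree
theorems — p684519 `stub_exactZeroGain_of_noCriminal` (…ExactPeel), p684531
`stub_compatibleAdhesion_of_exactZeroGain` (…ExactCompatible), p684998 `stub_certificate_iff`
(…ExactCertificate, Hakimi via Hall), p687756 `stub_replication` (…ExactReplication: flat lattice
translations …ExactFlatCore/…ExactFlat, covariance …ExactTranslate, bookkeeping …ExactPrep).  So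
`NoReconstructionGain → NoCriminal` is UNCONDITIONAL (`noCriminal_of_noReconstructionGain`: ONE criminal
refutes the crux for every `R, C`), and `NoReconstructionGain ↔ ExactZeroGain ↔ NoCriminal ↔
OrientationCertificate` hold modulo the residual `stub_wrappedCoreAdhesion` only.  OPEN: `stub_noCriminal`
(XL, the crux proper in exact form) and `stub_wrappedCoreAdhesion` (L, UNWRAP).

v2 (LEAD prover-crystal3d-wulff-p1-g17-0, 2026-08-29): the line is TAKEN UP by the lead of record after the
line `joint-level-support-bound` was fully harvested (its three provable stubs landed by name —
p675873 `stub_layeredAdhesion_of_jointBound`, p678618 `stub_jointBound_deepHeavy`, p681446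
`stub_jointBound_levelHeavy20` — and its only open stub `stub_adhesion_nonLayeredCore` is the crux on
non-layered cores, crux-sized; PREFERENCE of record: joint-level-support-bound > replication-exactness,
evidence #46).  CHANGES vs v1 (planner cruxplan-…-replication-exactness g0, @67236fabac27): the ten
definitions (`halfCrystal`, `IsFilmOn`, `plugSet`, `plugCount`, `ExactZeroGain`, `IsCriminal`,
`NoCriminal`, `OrientationCertificate`, `CompatibleAdhesion`, `WrappedCoreAdhesion`) now live VERBATIM in
the Theorems tree (`…NoReconstructionGainExactDefs`, p683799 ✓) so that the stubs can be landed BY NAME;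
the stub texts and the kernel-checked compositions below are unchanged (they now refer to the
`Summit.Ventures.Crystal3D.Theorems.*` names).  The landed theorems of `joint-level-support-bound` stay
available as rungs (every `(1/2,1/20)`-layered film is discharged with `C = 0`, hence is never a
criminal on the layered sector).


HONEST FRAMING: a typed SKELETON LINE for one crux of a FRONTIER venture (the sticky-sphere Wulff
constant).  Typed ≠ proved: the `stub_*` theorems below are `sorry`; only the compositions
`NoReconstructionGain_of`, `adhesion_of_exactZeroGain` and the `iff` corollaries are
kernel-checked (modulo the named stubs).  Nothing here proves the crux, the Wulff-constant conjecture or any packing summit.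

## Strategy (idea card `Ideas/replication-exactness.md`, with `integer-criminal-periodization` folded in)

The crux allows a deficit `C ρ`.  On the sector of films that stay clear of the infinite rigid slab
outside the sample, `C ρ` is WORTHLESS: a film gaining one bond against a flat face of the rigid
half-crystal can be replicated `≍ ρ²` times by FLAT LATTICE TRANSLATIONS (vectors of `Λ₀` of
`ν`-height in a window of width `δ_Q`, `≥ c ρ²` of them by pigeonhole — no face lattice, ALL unit
`ν`) on top of a lattice sample thickened by extra lattice balls, so a single gained bond becomes a
gain `≍ ρ² ≫ C ρ`.  Hence the crux is EQUIVALENT to the radius-free, constant-free integer statement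

  `ExactZeroGain`:  for every unit `ν`, every cut height `s` and every finite FILM `Q` on the
  half-crystal `H(ν,s) = Λ₀ ∩ {⟪p,ν⟫ ≤ s}` (pairwise `≥ 1`, `≥ 1` from every site of `H`):
  `#(substrate plugs of Q) ≤ D(Q) = 6·#Q − C(Q)`,

PLUS a residual about films that wrap into the collar of the finite sample (`stub_wrappedCoreAdhesion`,
the honest open remainder "UNWRAP", typed as the lead line's adhesion atom restricted to CORES that
come within distance `< 1` of an off-sample slab site, with the `C ρ` kept).  `ExactZeroGain` is in
turn put in MINIMAL-CRIMINAL normal form (`stub_noCriminal`: no nonempty film all of whose nonempty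
sub-blocks are strictly over-attached to substrate + rest — the fold-in of
`integer-criminal-periodization`), and shown to be a pure finite-combinatorics statement by Hakimi's
orientation theorem (`stub_certificate_iff`: exact zero gain ⟺ every film's contact graph has an
orientation with `indeg + plug ≤ 6` at every ball — so certificate search is WITHOUT LOSS).

Composition (kernel-checked below):
`stub_noCriminal → (stub_exactZeroGain_of_noCriminal) ExactZeroGain → (stub_compatibleAdhesion…,
stub_wrappedCoreAdhesion) the adhesion atom on cores → (tree: adhesion_of_core,
noReconstructionGain_of_adhesion) NoReconstructionGain`; and `stub_replication` closes the circle
`NoReconstructionGain ↔ ExactZeroGain ↔ NoCriminal ↔ OrientationCertificate` (given the residual).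

## Why this is novel (relative to the registered line `adhesion` and the other crux ideas)

* New MOVE: integrality + self-improvement by replication — the linear error term is removed, not
  estimated; the target becomes an exact integer inequality about finite films on a rigid
  half-crystal, for ALL `ν` at once (flat translations by pigeonhole replace face lattices).
* New NORMAL FORM: minimal criminal = substrate-LOADED strict core (`plug + deg ≥ 7` at every ball,
  off-site balls have `plug ≤ 3` by `fcc_offLattice_unitContacts_le_three`), decidable rungs
  `NoSmallCriminal(F,n)`; and COMPLETENESS of integral flow certificates (Hakimi), which the lead
  line's `adhesion_of_flow` only has in the sound direction.
* The lead line's single open stub `stub_adhesion_core` is SPLIT along a geometric invariant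
  (does the core reach the off-sample slab?): the compatible half is `ExactZeroGain` exactly
  (no `ρ`, no `C`), the wrapped half is the named residual.  The two lines meet at "cores".

## Stubs (priced S/M/L; hardest first)

| stub | statement | price | status |
|---|---|---|---|
| `stub_noCriminal` | no loaded strict core on any rigid half-crystal face | XL | OPEN — the crux proper, exact form |
| `stub_wrappedCoreAdhesion` | adhesion atom (`+Cρ`) for P-cores reaching an off-sample slab site, given EXACT₀ | L | OPEN — residual UNWRAP |
| `stub_replication` | `NoReconstructionGain → ExactZeroGain` (licence: a film gainer kills the crux for every `R`, `C`) | M math / L Lean | provable |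
| `stub_certificate_iff` | `ExactZeroGain ↔ OrientationCertificate` (Hakimi 1965 + counting) | M | provable (Hakimi unformalised) |
| `stub_compatibleAdhesion_of_exactZeroGain` | EXACT₀ ⇒ the atom with constant `0` on S-compatible packings, `R ≥ 3` | M | provable (covering radius `< 1` + split identity) |
| `stub_exactZeroGain_of_noCriminal` | peel a non-over-attached block, strong induction (mirror of `cross_le_of_core`) | S | provable |

Disproof used: none exists for this crux (`Cruxes/NoReconstructionGain/` has no `Disproof.lean`,
no `Negative/`; `ledger negatives --problem Ventures` is not registered) — recorded, not ignored.
-/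

namespace Summit.Ventures.Crystal3D.Cruxes.NoReconstructionGain.ReplicationExactness

open Literature.MathematicalPhysics.StatisticalMechanics (fccStacking contactDeficiency)
open Summit.Ventures.Crystal3D.Theorems
open scoped InnerProductSpace
open Finset

/-! ## Registered stubs -/

/-- **STUB (XL, OPEN — the crux proper in exact form): no criminal.**  A nonempty film on a rigid
half-crystal face all of whose nonempty sub-blocks are strictly over-attached does not exist.
Structure available to the prover: every ball has `plug + deg_Q ≥ 7`; off-site balls have
`plug ≤ 3` (`fcc_offLattice_unitContacts_le_three`) hence `deg_Q ≥ 4`; on-site balls have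
`plug ≤ 6`; a pure-lattice film is never a criminal (`latticeNoGain`-type line count); `#Q ≥ 3`. -/
theorem stub_noCriminal : NoCriminal := by
  sorry

/-- **STUB (S): peeling.**  If `Q` is not a criminal, some nonempty block `U` has
`D(U) ≥ X(H,U) + e(Q∖U,U)`; remove it and use `D(Q) = D(Q∖U) + D(U) − e(Q∖U,U)` and the induction
hypothesis for the film `Q ∖ U` (strong induction on `#Q`, mirror of `Theorems.cross_le_of_core`). -/
theorem stub_exactZeroGain_of_noCriminal : NoCriminal → ExactZeroGain :=
  Summit.Ventures.Crystal3D.Theorems.stub_exactZeroGain_of_noCriminal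

/-- **STUB (M): EXACT₀ ⇒ the atom with constant `0` on the compatible sector, `R ≥ 3`.**  Split the
film `X ∖ P` by height: every film ball is within distance `< 1` of a site of `Λ₀` (covering radius
`1/√2`), that site is not in the slab, so the ball lies above `−R − 1/√2` or below `−2R + 1/√2`;
the upper part is a film on `halfCrystal ν (−R)`, the lower part a film on `halfCrystal (−ν) (2R)`,
the two parts do not touch (`R ≥ 3`), `P`-contacts are plugs, and EXACT₀ twice gives
`#cross(P,X∖P) ≤ D(upper) + D(lower) = D(X∖P)` (`contactDeficiency_sdiff_split`). -/
theorem stub_compatibleAdhesion_of_exactZeroGain :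
    ExactZeroGain → ∀ R : ℝ, 3 ≤ R → CompatibleAdhesion R :=
  Summit.Ventures.Crystal3D.Theorems.stub_compatibleAdhesion_of_exactZeroGain

/-- **STUB (L, OPEN — the residual of v5, implied by the crux).**  The adhesion atom
`#cross(P, X∖P) ≤ D(X∖P) + Cρ` for P-cores carrying MORE than `L·⌊(R−6)/2⌋·ρ` off-lattice balls in the
deep height band `(−2R+2, −R−2)` (an off-lattice curtain of `≳ L R ρ / 2` balls outside the disc), for
some `L`, `R ≥ 8`, `C ≥ 0`.  Everything else is discharged by EXACT₀ through the level method.  Recommended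
attack: CONFINEMENT (`CoreWrappedConfinement ⟹` this, `manyWrappedCoreAdhesion_of_confinement`): blocks
of a core far outside the cylinder are bound only across an `O(R ρ)` surface while their deficiency grows
like `#^{2/3}`; what would kill confinement (not the stub): a tall film above the sample binding a wide
off-lattice collar whose every block still gains strictly. -/
theorem stub_manyWrappedCoreAdhesion : ManyWrappedCoreAdhesion := by
  sorry

/-- The structural confinement statement of v4 implies the v5 residual vacuously. -/
theorem manyWrappedCoreAdhesion_of_confinement (h : CoreWrappedConfinement) :
    ManyWrappedCoreAdhesion := by
  obtain ⟨L, R, hR, h⟩ := h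
  refine ⟨L, R, 0, hR, le_rfl, ?_⟩
  intro ν hν ρ hρ X P hX hPX hP hcore hmany
  have := h ν hν ρ hρ X P hX hPX hP hcore
  linarith

/-- **STUB (M math / L Lean): REPLICATION — the licence.**  If some film `Q` on `H(ν,s)` gains
(`D(Q) < X(H,Q)`), the crux fails for EVERY `R, C`: given `(R,C)`, put the lattice body
`L = Λ₀ ∩ {−2R' ≤ ⟪p,ν⟫ ≤ s+τ} ∩ Cyl(ρ')` (`τ` a lattice height with `s+τ ∈ [−R, −R+1]`,
`R' ≥ max(R, 2)`; `L ⊇ P_{ρ'}` — the packing may contain MORE lattice balls than the sample) and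
`M ≥ c_Q ρ'²` pairwise-far translates `Q + t + t_k`, `t_k ∈ Λ₀`, `⟪t_k,ν⟫ ∈ (−δ_Q, 0]`
(pigeonhole on heights of lattice vectors in a disc: `FlatTranslations`, all `ν`); each copy is
compatible with `L` and keeps its plugs (slack `δ_Q`), so `D = D(L) − M·gain ≤ 2φ(ν)πρ'² + C″ρ' − M`,
contradicting the crux at radius `ρ'` for `ρ'` large.  Integrality: `gain ≥ 1`. -/
theorem stub_replication :
    Summit.Ventures.Crystal3D.Theses.StickyWulffConstant.NoReconstructionGain → ExactZeroGain :=
  Summit.Ventures.Crystal3D.Theorems.stub_replication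

/-- **STUB (M): COMPLETENESS OF INTEGRAL FLOW CERTIFICATES (Hakimi 1965).**  `→`: EXACT₀ is
hereditary (a sub-film is a film), so every `U ⊆ Q` has `e(U) ≤ Σ_{q∈U} (6 − plug q)`, which is
Hakimi's condition for an orientation with `indeg ≤ 6 − plug` (finite max-flow / Hall on the
bond–ball incidence graph; not in Mathlib — port).  `←`: sum `indeg + plug ≤ 6` over `Q`. -/
theorem stub_certificate_iff : ExactZeroGain ↔ OrientationCertificate :=
  Summit.Ventures.Crystal3D.Theorems.stub_certificate_iff

/-! ## Kernel-checked compositions (v5) -/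

/-- **EXACT₀ + the residual ⟹ the adhesion atom on cores** (v5 route): for a core with few wrapped
off-lattice balls the deep-band level bound (`deficit_ge_of_exactZeroGain_sub_offLattice_deep`, from
EXACT₀) gives the atom with a linear remainder; for a core with many, the residual gives it.  (Stated with
the core atom — the hypothesis of the tree's `adhesion_of_core` — as conclusion.)  No `sorry`. -/
theorem coreAdhesion_of_exactZeroGain_of_residual (hE : ExactZeroGain)
    (hres : ManyWrappedCoreAdhesion) :
    ∃ R C : ℝ, 1 ≤ R ∧ ∀ ν : EuclideanSpace ℝ (Fin 3), ‖ν‖ = 1 → ∀ ρ : ℝ, R ≤ ρ →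
      ∀ X P : Finset (EuclideanSpace ℝ (Fin 3)),
      (∀ p ∈ X, ∀ q ∈ X, p ≠ q → 1 ≤ dist p q) → P ⊆ X →
      (∀ p, p ∈ P ↔ (p ∈ fccStacking 1 (Real.sqrt (2 / 3)) ∧ -(2 * R) ≤ ⟪p, ν⟫_ℝ ∧
        ⟪p, ν⟫_ℝ ≤ -R ∧ ‖p‖ ^ 2 - ⟪p, ν⟫_ℝ ^ 2 ≤ ρ ^ 2)) →
      (∀ S, S ⊆ X \ P → S.Nonempty →
        contactDeficiency S < (((((X \ S) ×ˢ S).filter fun pq => dist pq.1 pq.2 = 1).card : ℕ) : ℝ)) →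
      ((((P ×ˢ (X \ P)).filter fun pq => dist pq.1 pq.2 = 1).card : ℕ) : ℝ) ≤
        contactDeficiency (X \ P) + C * ρ := by
  classical
  obtain ⟨L, R, C, hR8, hC0, hres⟩ := hres
  obtain ⟨C₁, hC₁⟩ := deficit_ge_of_exactZeroGain_sub_offLattice_deep hE R hR8
  obtain ⟨C₂, hC₂⟩ := latticeBody_deficit_le_unif
  refine ⟨R, max C (C₁ + C₂ * (1 + R) + 12 * (max L 0 + 1)), by linarith, ?_⟩
  intro ν hν ρ hρ X P hX hPX hP hcore
  have hρ1 : 1 ≤ ρ := by linarith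
  have hρ0 : 0 ≤ ρ := by linarith
  have hmaxC : C * ρ ≤ max C (C₁ + C₂ * (1 + R) + 12 * (max L 0 + 1)) * ρ :=
    mul_le_mul_of_nonneg_right (le_max_left _ _) hρ0
  have hmaxC' : (C₁ + C₂ * (1 + R) + 12 * (max L 0 + 1)) * ρ ≤
      max C (C₁ + C₂ * (1 + R) + 12 * (max L 0 + 1)) * ρ :=
    mul_le_mul_of_nonneg_right (le_max_right _ _) hρ0
  set K : ℕ := ⌊(R - 6) / 2⌋₊ with hK
  set nS : ℕ := (X.filter fun x => x ∉ fccStacking 1 (Real.sqrt (2 / 3)) ∧ -(2 * R) + 2 < ⟪x, ν⟫_ℝ ∧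
    ⟪x, ν⟫_ℝ < -R - 2).card with hnS
  by_cases hmany : L * (K : ℝ) * ρ < nS
  · -- many wrapped off-lattice balls: the residual
    have h := hres ν hν ρ hρ X P hX hPX hP hcore hmany
    linarith
  · -- few: the level method
    push Not at hmany
    have h1 := hC₁ ν hν ρ hρ X P hX hPX hP
    have h2 := hC₂ ν hν R (by linarith) (-(2 * R)) (-R) (by ring) ρ hρ P hP
    have hsplit := contactDeficiency_sdiff_split hPX
    have hK1 : 1 ≤ K := by rw [hK]; exact (Nat.one_le_floor_iff _).2 (by linarith)
    have hKpos : (0 : ℝ) < K := by exact_mod_cast hK1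
    have hdiv : ((nS / K : ℕ) : ℝ) ≤ (nS : ℝ) / K := Nat.cast_div_le
    have hSK : (nS : ℝ) / K ≤ L * ρ := by
      rw [div_le_iff₀ hKpos]
      calc (nS : ℝ) ≤ L * (K : ℝ) * ρ := hmany
        _ = L * ρ * K := by ring
    have hmax : L * ρ ≤ max L 0 * ρ := mul_le_mul_of_nonneg_right (le_max_left L 0) hρ0
    have hm0 : 0 ≤ max L 0 := le_max_right L 0
    have hcost : (12 : ℝ) * (((nS / K : ℕ) : ℝ) + 1) ≤ 12 * (max L 0 + 1) * ρ := by nlinarith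
    nlinarith [h1, h2, hsplit, hcost, hρ0, hmaxC']

/-- **THE LINE'S COMPOSITION (v5)** — the registered stubs, BY NAME, imply the crux BY NAME:
`stub_noCriminal` (⟹ EXACT₀ by the landed `stub_exactZeroGain_of_noCriminal`) and
`stub_manyWrappedCoreAdhesion` ⟹ `NoReconstructionGain`.  No `sorry` outside the stubs. -/
theorem NoReconstructionGain_of :
    Summit.Ventures.Crystal3D.Theses.StickyWulffConstant.NoReconstructionGain :=
  Summit.Ventures.Crystal3D.Theorems.noReconstructionGain_of_adhesion
    (Summit.Ventures.Crystal3D.Theorems.adhesion_of_core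
      (coreAdhesion_of_exactZeroGain_of_residual
        (stub_exactZeroGain_of_noCriminal stub_noCriminal) stub_manyWrappedCoreAdhesion))

/- (The parametrised forms `EXACT₀ + residual ⟹ crux` and `EXACT₀ + CONFINEMENT ⟹ crux` are the one-liners
`noReconstructionGain_of_adhesion (adhesion_of_core (coreAdhesion_of_exactZeroGain_of_residual hE hres))`
resp. `… (manyWrappedCoreAdhesion_of_confinement hconf)`; they are not stated as theorems here so that
`NoReconstructionGain_of` is the unique closer of the skeleton.) -/

/-- EXACT₀ ⇒ no criminal (take `U = Q`; proved outright). -/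
theorem noCriminal_of_exactZeroGain (hE : ExactZeroGain) : NoCriminal := by
  classical
  intro ν hν s Q hQ
  obtain ⟨hfilm, hne, hcore⟩ := hQ
  have h1 := hcore Q (Finset.Subset.refl Q) hne
  have h2 := hE ν hν s Q hfilm
  simp only [Finset.sdiff_self, Finset.empty_product, Finset.filter_empty, Finset.card_empty,
    Nat.cast_zero, add_zero] at h1
  linarith

/-- **The licence closes the circle** (modulo the residual `stub_manyWrappedCoreAdhesion`, used by
name; `→` is the LANDED `stub_replication`, unconditional): the crux is EQUIVALENT to exact zero gain … -/
theorem noReconstructionGain_iff_exactZeroGain :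
    Summit.Ventures.Crystal3D.Theses.StickyWulffConstant.NoReconstructionGain ↔ ExactZeroGain :=
  ⟨stub_replication, fun hE =>
    Summit.Ventures.Crystal3D.Theorems.noReconstructionGain_of_adhesion
      (Summit.Ventures.Crystal3D.Theorems.adhesion_of_core
        (coreAdhesion_of_exactZeroGain_of_residual hE stub_manyWrappedCoreAdhesion))⟩

/-- … to the non-existence of a criminal (so ONE criminal — a finite object on a rigid half-crystal —
refutes the crux for every `R`, `C`: `CriminalRefutes` of the folded card, for all `ν`) … -/
theorem noReconstructionGain_iff_noCriminal :
    Summit.Ventures.Crystal3D.Theses.StickyWulffConstant.NoReconstructionGain ↔ NoCriminal :=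
  ⟨fun h => noCriminal_of_exactZeroGain (stub_replication h), fun h =>
    noReconstructionGain_iff_exactZeroGain.2 (stub_exactZeroGain_of_noCriminal h)⟩

/-- … and to the existence of an orientation certificate for every film (certificate search is
WITHOUT LOSS). -/
theorem noReconstructionGain_iff_certificate :
    Summit.Ventures.Crystal3D.Theses.StickyWulffConstant.NoReconstructionGain ↔
      OrientationCertificate :=
  noReconstructionGain_iff_exactZeroGain.trans stub_certificate_iff

end Summit.Ventures.Crystal3D.Cruxes.NoReconstructionGain.ReplicationExactness
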